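import Literature.NumberTheory.CubicFields.ThreeTorsionMeanTwoAdicSieve
import HarnessLib

/-!
# Taniguchi–Thorne at the prime `2`: the sieve assembly with `Q = X^{5/23}` (the exponent `18/23`)

Topic `Literature/NumberTheory/CubicFields`, continuing `ThreeTorsionMeanTwoAdicSieve.lean` (which
reduces the named fact `QuadraticFields.tt_threeTorsion_twoAdic` — Taniguchi–Thorne 2013, Thm 4 with
§6.3 and Thm 25 at the prime `2` — to Hasse's dictionary and two-term estimates / twisted bounds for
the exact Möbius sums `Σ_{q ≤ X odd} μ(q) N^±_q(X; r, s)` over the level-`q` orbit counts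
`N^±_q(X; r, s) = irredOrbitCount (±1) {f | Disc f ≡ rs (8r), q² ∣ Disc f} X`). This file PROVES the
last paragraph of the printed proof of Theorem 2 (= the `3`-torsion exponent `18/23`, §6.1, used
verbatim for Theorems 4 and 25 in §6.3/§6.6), Taniguchi–Thorne arXiv:1102.2914 p. 19:

"Lemma (BBP) establishes that we may again truncate the sum to `q ≤ Q` with error `≪ X/Q^{1−ε}`. …
We split the sum over `q ≤ Q` into `q ≤ X^{1/6}` and `X^{1/6} < q ≤ Q`. We choose `y = X/Q` … the
contribution of [the first] range … is bounded by `X^{17/24+ε}` so long as `y ≥ X^{3/4}`. In the range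
`X^{1/6} < q ≤ Q` … we obtain a contribution to `M(X) − R_Q(X)` of `Q^{15/8+ε} X^{3/8} + Q^{7/2+ε} +
X^{1+ε}/Q`. Because of the new first term, the optimal choice is `Q = X^{5/23}`, which gives an error
term of `X^{18/23+ε}`. … We replace the sums over `q ≤ Q` by the appropriate Euler products, with
error `≪ X Q^{−1+ε} + X^{5/6} Q^{−2/3+ε}`."

* `tt_sieve_assembly` — the abstract assembly in a real normed space: an exact sieve identity
  `F(X) = Σ_{q ≤ X} μ(q) N_q(X)`, the core bound for `q ≤ Q ≤ X^{1/4}` (HYPOTHESIS — the analytic heart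
  of the paper: Shintani zeta functions / orbital `L`-functions of level `q`, their functional
  equations and the Chandrasekharan–Narasimhan estimate, §§3–5), uniformity `‖N_q(X)‖ ≤ C_ε q^ε X/q²`,
  and the Euler-product completions give `F(X) = A X + B X^{5/6} + O_ε(X^{18/23+ε})`; the exponent
  bookkeeping is `tt_exp_bound₁…₅` (`(5/23)(15/8) + 3/8 = 18/23`, `(5/23)(7/2) ≤ 18/23`,
  `1 − 5/23 = 18/23`, `5/6 − (2/3)(5/23) ≤ 18/23`, `17/24 ≤ 18/23`) with `Q = ⌊X^{5/23}⌋`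
  (`tt_truncation_facts`), and the truncation tail is `norm_sum_Ioc_moebius_smul_le`
  (`Σ_{q>Q} q⁻² ≤ 1/Q`).
* `pow_card_primeFactors_le_rpow` (`K^{ω(q)} ≤ C_δ q^δ`), `irredOrbitCount_sqDvd_le_of_uniformity`,
  `irredOrbitCount_sqDvd_le_rpow` — the uniformity input for the level-`q` type counts from the tree's
  named fact `btt_uniformity_sqDvd` (BTT Prop. 4.5 = Lemma 3.3 of Belabas–Bhargava–Pomerance, the
  paper's Lemma (BBP)): `N^±_q(X; T) ≤ C 6^{ω(q)} X/q² ≤ C_ε q^ε X/q²`.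
* `tt_typeCount_neg_of_core`, `tt_typeCount_pos_of_core` — per type and sign, the two-term count
  `Σ_{0<∓D<X fund., D ≡ rs (8r)} #irredOrbitsOfDisc D = A X + B X^{5/6} + O_ε(X^{18/23+ε})` from the
  uniformity fact and the analytic core (real case, `E = ℝ`).
* `tt_typeTwist_neg_of_core`, `tt_typeTwist_pos_of_core` — per type, sign and Dirichlet character `ψ`:
  the twisted sums `Σ ψ(D/r) #irredOrbitsOfDisc D = O_ε(X^{18/23+ε})` from the uniformity fact
  (`‖ψ‖ ≤ 1`) and the twisted core bound (Thm 25, `ψ⁶ ≠ 1`: no residues; `E = ℂ`).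
* **`tt_threeTorsion_twoAdic_of_core`** — the named fact from: Hasse's dictionary
  (`threeTorsion_eq_two_mul_cubicFieldCountOfDisc_add_one`), `btt_uniformity_sqDvd`, and for each of
  the eight types and both signs the analytic core with `A = 1/(2rπ²)` (`D < 0`), `1/(6rπ²)` (`D > 0`)
  (the residues at `s = 1` with the `2`-adic densities `C'(𝒮) = 1/(3r)` of §6.2–6.3), plus the twisted
  core bounds for primitive `ψ (mod 2ʲ)`, `j ≥ 4`, `ψ⁶ ≠ 1`.

Nothing here is a new named fact; the two named facts used as hypotheses exist in the tree.

## References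

* T. Taniguchi, F. Thorne, *Secondary terms in counting functions for cubic fields*, Duke Math. J.
  162 (2013) 2451–2508 = arXiv:1102.2914, §6.1 (proof of Thm 2, p. 19), §6.3, Thm 25 (§6.6)
  [TaniguchiThorne2013].
* M. Bhargava, T. Taniguchi, F. Thorne, Math. Ann. 389 (2024) = arXiv:2107.12819, Prop. 4.5
  [BhargavaTaniguchiThorne2023].
* K. Belabas, M. Bhargava, C. Pomerance, Duke Math. J. 153 (2010), Lemma 3.3 [BelabasBhargavaPomerance2010].
-/

noncomputable section

open Finset
open scoped ArithmeticFunction.Moebius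

namespace Literature.NumberTheory.CubicFields

open BinaryCubic Literature.NumberTheory.QuadraticFields
open Literature.NumberTheory.LFunctions (abs_moebius_real_le_one)

/-! ### Real-analysis preliminaries: the truncation parameter `Q = ⌊X^{5/23}⌋` -/

section Prelim

/-- The truncation parameter: for `X ≥ 1` and `Q = ⌊X^{5/23}⌋`, `1 ≤ Q ≤ X`, `Q ≤ X^{5/23} ≤ 2Q` and
`Q ≤ X^{1/4}`. [cite: TaniguchiThorne2013, §6.1 ("the optimal choice is Q = X^{5/23}")] -/
theorem tt_truncation_facts {X : ℕ} (hX : 1 ≤ X) :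
    1 ≤ ⌊(X : ℝ) ^ ((5 : ℝ) / 23)⌋₊ ∧ ⌊(X : ℝ) ^ ((5 : ℝ) / 23)⌋₊ ≤ X ∧
      ((⌊(X : ℝ) ^ ((5 : ℝ) / 23)⌋₊ : ℕ) : ℝ) ≤ (X : ℝ) ^ ((5 : ℝ) / 23) ∧
      (X : ℝ) ^ ((5 : ℝ) / 23) ≤ 2 * ((⌊(X : ℝ) ^ ((5 : ℝ) / 23)⌋₊ : ℕ) : ℝ) ∧
      ((⌊(X : ℝ) ^ ((5 : ℝ) / 23)⌋₊ : ℕ) : ℝ) ≤ (X : ℝ) ^ ((1 : ℝ) / 4) := by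
  set x : ℝ := (X : ℝ) with hxdef
  have hx1 : (1 : ℝ) ≤ x := by rw [hxdef]; exact_mod_cast hX
  have hx0 : (0 : ℝ) ≤ x := zero_le_one.trans hx1
  set y : ℝ := x ^ ((5 : ℝ) / 23) with hydef
  have hy1 : 1 ≤ y := Real.one_le_rpow hx1 (by norm_num)
  have hy0 : 0 ≤ y := zero_le_one.trans hy1
  have hQ1 : 1 ≤ ⌊y⌋₊ := Nat.le_floor (by exact_mod_cast hy1)
  have hfl : ((⌊y⌋₊ : ℕ) : ℝ) ≤ y := Nat.floor_le hy0
  have hlt : y < ((⌊y⌋₊ : ℕ) : ℝ) + 1 := Nat.lt_floor_add_one y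
  refine ⟨hQ1, ?_, hfl, ?_, ?_⟩
  · have hyx : y ≤ x := by
      calc y ≤ x ^ (1 : ℝ) := Real.rpow_le_rpow_of_exponent_le hx1 (by norm_num)
        _ = x := Real.rpow_one x
    have h := Nat.floor_le_floor hyx
    rwa [hxdef, Nat.floor_natCast] at h
  · have h1 : (1 : ℝ) ≤ ((⌊y⌋₊ : ℕ) : ℝ) := by exact_mod_cast hQ1
    linarith
  · exact hfl.trans (Real.rpow_le_rpow_of_exponent_le hx1 (by norm_num))

/-- `Q^{15/8} X^{3/8} ≤ X^{18/23}` for `0 ≤ Q ≤ X^{5/23}`, `X ≥ 1` (`(5/23)(15/8) + 3/8 = 18/23`).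
[cite: TaniguchiThorne2013, §6.1 (choice of Q)] -/
theorem tt_exp_bound₁ {x Q : ℝ} (hx : 1 ≤ x) (hQ0 : 0 ≤ Q) (hQ : Q ≤ x ^ ((5 : ℝ) / 23)) :
    Q ^ ((15 : ℝ) / 8) * x ^ ((3 : ℝ) / 8) ≤ x ^ ((18 : ℝ) / 23) := by
  have hx0 : 0 ≤ x := zero_le_one.trans hx
  have h1 : Q ^ ((15 : ℝ) / 8) ≤ x ^ ((75 : ℝ) / 184) := by
    calc Q ^ ((15 : ℝ) / 8) ≤ (x ^ ((5 : ℝ) / 23)) ^ ((15 : ℝ) / 8) :=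
          Real.rpow_le_rpow hQ0 hQ (by norm_num)
      _ = x ^ ((5 : ℝ) / 23 * ((15 : ℝ) / 8)) := (Real.rpow_mul hx0 _ _).symm
      _ = x ^ ((75 : ℝ) / 184) := by norm_num
  calc Q ^ ((15 : ℝ) / 8) * x ^ ((3 : ℝ) / 8) ≤ x ^ ((75 : ℝ) / 184) * x ^ ((3 : ℝ) / 8) := by
        gcongr
    _ = x ^ ((75 : ℝ) / 184 + (3 : ℝ) / 8) := (Real.rpow_add (by linarith) _ _).symm
    _ = x ^ ((18 : ℝ) / 23) := by norm_num

/-- `Q^{7/2} ≤ X^{18/23}` for `0 ≤ Q ≤ X^{5/23}`, `X ≥ 1` (`(5/23)(7/2) = 35/46 ≤ 36/46`).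
[cite: TaniguchiThorne2013, §6.1 (choice of Q)] -/
theorem tt_exp_bound₂ {x Q : ℝ} (hx : 1 ≤ x) (hQ0 : 0 ≤ Q) (hQ : Q ≤ x ^ ((5 : ℝ) / 23)) :
    Q ^ ((7 : ℝ) / 2) ≤ x ^ ((18 : ℝ) / 23) := by
  have hx0 : 0 ≤ x := zero_le_one.trans hx
  calc Q ^ ((7 : ℝ) / 2) ≤ (x ^ ((5 : ℝ) / 23)) ^ ((7 : ℝ) / 2) := Real.rpow_le_rpow hQ0 hQ (by norm_num)
    _ = x ^ ((5 : ℝ) / 23 * ((7 : ℝ) / 2)) := (Real.rpow_mul hx0 _ _).symm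
    _ ≤ x ^ ((18 : ℝ) / 23) := Real.rpow_le_rpow_of_exponent_le hx (by norm_num)

/-- `X / Q ≤ 2 X^{18/23}` when `X^{5/23} ≤ 2Q`, `0 < Q`, `X ≥ 1`. [cite: TaniguchiThorne2013, §6.1 (choice of Q)] -/
theorem tt_exp_bound₃ {x Q : ℝ} (hx : 1 ≤ x) (hQ : x ^ ((5 : ℝ) / 23) ≤ 2 * Q) :
    x / Q ≤ 2 * x ^ ((18 : ℝ) / 23) := by
  have hxpos : 0 < x := by linarith
  have hy : 0 < x ^ ((5 : ℝ) / 23) := Real.rpow_pos_of_pos hxpos _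
  calc x / Q ≤ x / (x ^ ((5 : ℝ) / 23) / 2) :=
        div_le_div_of_nonneg_left (by linarith) (by positivity) (by linarith)
    _ = 2 * (x ^ (1 : ℝ) / x ^ ((5 : ℝ) / 23)) := by rw [Real.rpow_one]; ring
    _ = 2 * x ^ ((1 : ℝ) - (5 : ℝ) / 23) := by rw [← Real.rpow_sub hxpos]
    _ = 2 * x ^ ((18 : ℝ) / 23) := by norm_num

/-- `X^{5/6} / Q^{2/3} ≤ 2 X^{18/23}` when `X^{5/23} ≤ 2Q`, `0 < Q`, `X ≥ 1`
(`5/6 − (2/3)(5/23) = 95/138 ≤ 108/138`, `2^{2/3} ≤ 2`). [cite: TaniguchiThorne2013, §6.1 (choice of Q)] -/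
theorem tt_exp_bound₄ {x Q : ℝ} (hx : 1 ≤ x) (hQ0 : 0 < Q) (hQ : x ^ ((5 : ℝ) / 23) ≤ 2 * Q) :
    x ^ ((5 : ℝ) / 6) / Q ^ ((2 : ℝ) / 3) ≤ 2 * x ^ ((18 : ℝ) / 23) := by
  have hxpos : 0 < x := by linarith
  have hx0 : 0 ≤ x := hxpos.le
  have hy : 0 < x ^ ((5 : ℝ) / 23) := Real.rpow_pos_of_pos hxpos _
  -- `x^{10/69} ≤ 2 Q^{2/3}`
  have h1 : x ^ ((10 : ℝ) / 69) ≤ 2 * Q ^ ((2 : ℝ) / 3) := by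
    have h2 : (2 : ℝ) ^ ((2 : ℝ) / 3) ≤ 2 := by
      calc (2 : ℝ) ^ ((2 : ℝ) / 3) ≤ (2 : ℝ) ^ (1 : ℝ) := Real.rpow_le_rpow_of_exponent_le (by norm_num) (by norm_num)
        _ = 2 := Real.rpow_one 2
    calc x ^ ((10 : ℝ) / 69) = x ^ ((5 : ℝ) / 23 * ((2 : ℝ) / 3)) := by norm_num
      _ = (x ^ ((5 : ℝ) / 23)) ^ ((2 : ℝ) / 3) := Real.rpow_mul hx0 _ _
      _ ≤ (2 * Q) ^ ((2 : ℝ) / 3) := Real.rpow_le_rpow hy.le hQ (by norm_num)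
      _ = (2 : ℝ) ^ ((2 : ℝ) / 3) * Q ^ ((2 : ℝ) / 3) := Real.mul_rpow (by norm_num) hQ0.le
      _ ≤ 2 * Q ^ ((2 : ℝ) / 3) := by gcongr
  have hq : 0 < Q ^ ((2 : ℝ) / 3) := Real.rpow_pos_of_pos hQ0 _
  have hx10 : 0 < x ^ ((10 : ℝ) / 69) := Real.rpow_pos_of_pos hxpos _
  have hc : 0 < x ^ ((10 : ℝ) / 69) / 2 := by positivity
  have hcb : x ^ ((10 : ℝ) / 69) / 2 ≤ Q ^ ((2 : ℝ) / 3) := by linarith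
  calc x ^ ((5 : ℝ) / 6) / Q ^ ((2 : ℝ) / 3) ≤ x ^ ((5 : ℝ) / 6) / (x ^ ((10 : ℝ) / 69) / 2) :=
        div_le_div_of_nonneg_left (Real.rpow_nonneg hx0 _) hc hcb
    _ = 2 * (x ^ ((5 : ℝ) / 6) / x ^ ((10 : ℝ) / 69)) := by ring
    _ = 2 * x ^ ((5 : ℝ) / 6 - (10 : ℝ) / 69) := by rw [← Real.rpow_sub hxpos]
    _ ≤ 2 * x ^ ((18 : ℝ) / 23) := by
        have := Real.rpow_le_rpow_of_exponent_le (y := (5 : ℝ) / 6 - (10 : ℝ) / 69) (z := (18 : ℝ) / 23) hx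
          (by norm_num)
        linarith

/-- `X^{17/24} ≤ X^{18/23}` for `X ≥ 1`. [cite: TaniguchiThorne2013, §6.1 (the range q ≤ X^{1/6})] -/
theorem tt_exp_bound₅ {x : ℝ} (hx : 1 ≤ x) : x ^ ((17 : ℝ) / 24) ≤ x ^ ((18 : ℝ) / 23) :=
  Real.rpow_le_rpow_of_exponent_le hx (by norm_num)

/-- `Σ_{Q < q ≤ X} 1/q² ≤ 1/Q` (`Q ≥ 1`). [folklore] -/
theorem sum_Ioc_inv_sq_le_inv {Q X : ℕ} (hQ : 1 ≤ Q) (hQX : Q ≤ X) :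
    ∑ q ∈ Ioc Q X, ((q : ℝ) ^ 2)⁻¹ ≤ (Q : ℝ)⁻¹ := by
  have h := sum_Ioc_inv_sq_le_sub (α := ℝ) (k := Q) (n := X) (by omega) hQX
  have hX : 0 ≤ (X : ℝ)⁻¹ := by positivity
  linarith

end Prelim

/-! ### The Möbius coefficients -/

/-- For `Q < q ≤ X`: the `q`-th sieved term is `≤ C X^ε X / q²` in norm, given the uniformity bound
`‖N_q(X)‖ ≤ C q^ε X/q²` at squarefree `q` (non-squarefree `q` have `μ(q) = 0`). [folklore] -/
theorem norm_moebius_smul_le {E : Type*} [NormedAddCommGroup E] [NormedSpace ℝ E] {C ε : ℝ} (hC : 0 ≤ C)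
    (hε : 0 ≤ ε) {X q : ℕ} (hq1 : 1 ≤ q) (hqX : q ≤ X) {v : E}
    (hv : Squarefree q → ‖v‖ ≤ C * (q : ℝ) ^ ε * (X : ℝ) / (q : ℝ) ^ 2) :
    ‖(μ q : ℝ) • v‖ ≤ C * (X : ℝ) ^ ε * (X : ℝ) * ((q : ℝ) ^ 2)⁻¹ := by
  have hq0 : (0 : ℝ) < q := by exact_mod_cast hq1
  have hbound : 0 ≤ C * (X : ℝ) ^ ε * (X : ℝ) * ((q : ℝ) ^ 2)⁻¹ := by positivity
  by_cases hsq : Squarefree q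
  · rw [norm_smul, Real.norm_eq_abs]
    have hqε : (q : ℝ) ^ ε ≤ (X : ℝ) ^ ε := Real.rpow_le_rpow hq0.le (by exact_mod_cast hqX) hε
    calc |(μ q : ℝ)| * ‖v‖ ≤ 1 * (C * (q : ℝ) ^ ε * (X : ℝ) / (q : ℝ) ^ 2) := by
          gcongr
          · exact abs_moebius_real_le_one q
          · exact hv hsq
      _ = C * (q : ℝ) ^ ε * (X : ℝ) * ((q : ℝ) ^ 2)⁻¹ := by rw [one_mul, div_eq_mul_inv]
      _ ≤ C * (X : ℝ) ^ ε * (X : ℝ) * ((q : ℝ) ^ 2)⁻¹ := by gcongr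
  · rw [ArithmeticFunction.moebius_eq_zero_of_not_squarefree hsq, Int.cast_zero, zero_smul, norm_zero]
    exact hbound

/-- **The truncated tail `Σ_{Q<q≤X} μ(q) N_q(X)` is `≤ C X^{1+ε}/Q`** from the uniformity bound
`‖N_q(X)‖ ≤ C q^ε X/q²` (Taniguchi–Thorne: "Lemma (BBP) establishes that we may again truncate the
sum to `q ≤ Q` with error `≪ X/Q^{1−ε}`"). [cite: TaniguchiThorne2013, §6.1 (truncation to q ≤ Q)] -/
theorem norm_sum_Ioc_moebius_smul_le {E : Type*} [NormedAddCommGroup E] [NormedSpace ℝ E]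
    (P : ℕ → Prop) [DecidablePred P] {C ε : ℝ} (hC : 0 ≤ C) (hε : 0 ≤ ε) {X Q : ℕ} (hQ : 1 ≤ Q)
    (hQX : Q ≤ X) {N : ℕ → E}
    (hN : ∀ q : ℕ, Q < q → q ≤ X → P q → Squarefree q → ‖N q‖ ≤ C * (q : ℝ) ^ ε * (X : ℝ) / (q : ℝ) ^ 2) :
    ‖∑ q ∈ (Ioc Q X).filter P, (μ q : ℝ) • N q‖ ≤ C * (X : ℝ) ^ ε * (X : ℝ) / Q := by
  calc ‖∑ q ∈ (Ioc Q X).filter P, (μ q : ℝ) • N q‖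
      ≤ ∑ q ∈ (Ioc Q X).filter P, ‖(μ q : ℝ) • N q‖ := norm_sum_le _ _
    _ ≤ ∑ q ∈ (Ioc Q X).filter P, C * (X : ℝ) ^ ε * (X : ℝ) * ((q : ℝ) ^ 2)⁻¹ := by
        refine Finset.sum_le_sum fun q hq => ?_
        rw [Finset.mem_filter, Finset.mem_Ioc] at hq
        exact norm_moebius_smul_le hC hε (by omega) hq.1.2 (hN q hq.1.1 hq.1.2 hq.2)
    _ ≤ ∑ q ∈ Ioc Q X, C * (X : ℝ) ^ ε * (X : ℝ) * ((q : ℝ) ^ 2)⁻¹ :=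
        Finset.sum_le_sum_of_subset_of_nonneg (Finset.filter_subset _ _) fun q _ _ => by positivity
    _ = C * (X : ℝ) ^ ε * (X : ℝ) * ∑ q ∈ Ioc Q X, ((q : ℝ) ^ 2)⁻¹ := by rw [Finset.mul_sum]
    _ ≤ C * (X : ℝ) ^ ε * (X : ℝ) * (Q : ℝ)⁻¹ := by
        gcongr
        exact sum_Ioc_inv_sq_le_inv hQ hQX
    _ = C * (X : ℝ) ^ ε * (X : ℝ) / Q := by rw [div_eq_mul_inv]

/-- Splitting the sieve at `Q`: `Σ_{q ≤ X} = Σ_{q ≤ Q} + Σ_{Q < q ≤ X}` (`1 ≤ Q ≤ X`). [folklore] -/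
theorem sum_Icc_filter_split {M : Type*} [AddCommMonoid M] (P : ℕ → Prop) [DecidablePred P]
    (f : ℕ → M) {Q X : ℕ} (hQX : Q ≤ X) :
    ∑ q ∈ (Icc 1 X).filter P, f q = ∑ q ∈ (Icc 1 Q).filter P, f q + ∑ q ∈ (Ioc Q X).filter P, f q := by
  rw [← Finset.sum_filter_add_sum_filter_not ((Icc 1 X).filter P) (fun q => q ≤ Q)]
  congr 1
  · congr 1
    ext q
    simp only [Finset.mem_filter, Finset.mem_Icc]
    constructor
    · rintro ⟨⟨h1, hP⟩, h2⟩; exact ⟨⟨h1.1, h2⟩, hP⟩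
    · rintro ⟨h1, hP⟩; exact ⟨⟨⟨h1.1, h1.2.trans hQX⟩, hP⟩, h1.2⟩
  · congr 1
    ext q
    simp only [Finset.mem_filter, Finset.mem_Icc, Finset.mem_Ioc, not_le]
    constructor
    · rintro ⟨⟨h1, hP⟩, h2⟩; exact ⟨⟨h2, h1.2⟩, hP⟩
    · rintro ⟨h1, hP⟩; exact ⟨⟨⟨by omega, h1.2⟩, hP⟩, h1.1⟩

/-! ### The assembly (Taniguchi–Thorne §6.1: "the optimal choice is `Q = X^{5/23}`") -/

/-- **Taniguchi–Thorne's sieve assembly with `Q = X^{5/23}`** (the last paragraph of the proof of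
their Theorem 2 = our exponent `18/23`, §6.1, abstracted). Let `F(X) = Σ_{q ≤ X, P q} μ(q) N_q(X)`
(an exact sieve identity; here `P` = "odd", `N_q` the level-`q` counts). Assume:
`hcore` — the paper's bound for the contribution of `q ≤ Q` to `M(X) − R_Q(X)`: for `1 ≤ Q ≤ X^{1/4}`,
`‖Σ_{q ≤ Q} μ(q) (N_q(X) − X·a_q − X^{5/6}·b_q)‖ ≤ C_ε X^ε (X^{17/24} + Q^{15/8} X^{3/8} + Q^{7/2} + X/Q)`
(§6.1, the two ranges `q ≤ X^{1/6}` and `X^{1/6} < q ≤ Q` with `y = X/Q ≥ X^{3/4}`; `a_q`, `b_q` the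
residues of the level-`q` zeta function at `s = 1`, `5/6`); `hunif` — uniformity
`‖N_q(X)‖ ≤ C_ε q^ε X/q²` at squarefree `q` (Lemma (BBP)); `ha`, `hb` — completing the residue sums
to their Euler products: `‖A − Σ_{q ≤ Q} μ(q) a_q‖ ≤ C_ε Q^ε/Q`, `‖B − Σ_{q ≤ Q} μ(q) b_q‖ ≤ C_ε Q^ε/Q^{2/3}`
("We replace the sums over `q ≤ Q` by the appropriate Euler products, with error
`≪ X Q^{-1+ε} + X^{5/6} Q^{-2/3+ε}`"). Then `F(X) = A X + B X^{5/6} + O_ε(X^{18/23+ε})`: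
with `Q = ⌊X^{5/23}⌋` every error is `≪ X^{18/23+ε}` (`tt_exp_bound₁…₅`). Stated in a real normed
space `E` (`E = ℝ` for counts, `E = ℂ` for character twists).
[cite: TaniguchiThorne2013, §6.1 (proof of Theorem 2: truncation, the two ranges, Q = X^{5/23})] -/
theorem tt_sieve_assembly {E : Type*} [NormedAddCommGroup E] [NormedSpace ℝ E]
    (P : ℕ → Prop) [DecidablePred P] {F : ℕ → E} {N : ℕ → ℕ → E} {a b : ℕ → E} {A B : E}
    (hF : ∀ X : ℕ, 1 ≤ X → F X = ∑ q ∈ (Icc 1 X).filter P, (μ q : ℝ) • N q X)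
    (hcore : ∀ ε : ℝ, 0 < ε → ∃ C : ℝ, ∀ X Q : ℕ, 1 ≤ X → 1 ≤ Q → (Q : ℝ) ≤ (X : ℝ) ^ ((1 : ℝ) / 4) →
      ‖∑ q ∈ (Icc 1 Q).filter P,
          (μ q : ℝ) • (N q X - (X : ℝ) • a q - ((X : ℝ) ^ ((5 : ℝ) / 6)) • b q)‖
        ≤ C * (X : ℝ) ^ ε * ((X : ℝ) ^ ((17 : ℝ) / 24) + (Q : ℝ) ^ ((15 : ℝ) / 8) * (X : ℝ) ^ ((3 : ℝ) / 8)
            + (Q : ℝ) ^ ((7 : ℝ) / 2) + (X : ℝ) / Q))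
    (hunif : ∀ ε : ℝ, 0 < ε → ∃ C : ℝ, ∀ X q : ℕ, 1 ≤ X → 1 ≤ q → q ≤ X → P q → Squarefree q →
      ‖N q X‖ ≤ C * (q : ℝ) ^ ε * (X : ℝ) / (q : ℝ) ^ 2)
    (ha : ∀ ε : ℝ, 0 < ε → ∃ C : ℝ, ∀ Q : ℕ, 1 ≤ Q →
      ‖A - ∑ q ∈ (Icc 1 Q).filter P, (μ q : ℝ) • a q‖ ≤ C * (Q : ℝ) ^ ε / Q)
    (hb : ∀ ε : ℝ, 0 < ε → ∃ C : ℝ, ∀ Q : ℕ, 1 ≤ Q →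
      ‖B - ∑ q ∈ (Icc 1 Q).filter P, (μ q : ℝ) • b q‖ ≤ C * (Q : ℝ) ^ ε / (Q : ℝ) ^ ((2 : ℝ) / 3)) :
    ∀ ε : ℝ, 0 < ε → ∃ C : ℝ, ∀ X : ℕ, 1 ≤ X →
      ‖F X - (X : ℝ) • A - ((X : ℝ) ^ ((5 : ℝ) / 6)) • B‖ ≤ C * (X : ℝ) ^ ((18 : ℝ) / 23 + ε) := by
  intro ε hε
  obtain ⟨C₁, hC₁⟩ := hcore ε hε
  obtain ⟨C₂, hC₂⟩ := hunif ε hε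
  obtain ⟨C₃, hC₃⟩ := ha ε hε
  obtain ⟨C₄, hC₄⟩ := hb ε hε
  refine ⟨5 * max C₁ 0 + 2 * max C₂ 0 + 2 * max C₃ 0 + 2 * max C₄ 0, fun X hX => ?_⟩
  obtain ⟨hQ1, hQX, hQle, hQge, hQ14⟩ := tt_truncation_facts hX
  set Q : ℕ := ⌊(X : ℝ) ^ ((5 : ℝ) / 23)⌋₊ with hQdef
  set x : ℝ := (X : ℝ) with hxdef
  have hx1 : (1 : ℝ) ≤ x := by rw [hxdef]; exact_mod_cast hX
  have hxpos : (0 : ℝ) < x := by linarith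
  have hQpos : (0 : ℝ) < Q := by exact_mod_cast hQ1
  have hQ1r : (1 : ℝ) ≤ Q := by exact_mod_cast hQ1
  have hQx : (Q : ℝ) ≤ x := by rw [hxdef]; exact_mod_cast hQX
  have hxε : 0 < x ^ ε := Real.rpow_pos_of_pos hxpos ε
  have h18 : 0 < x ^ ((18 : ℝ) / 23) := Real.rpow_pos_of_pos hxpos _
  have hmain : x ^ ((18 : ℝ) / 23 + ε) = x ^ ((18 : ℝ) / 23) * x ^ ε := Real.rpow_add hxpos _ _
  -- the four pieces
  set S₁ : E := ∑ q ∈ (Icc 1 Q).filter P,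
      (μ q : ℝ) • (N q X - (X : ℝ) • a q - ((X : ℝ) ^ ((5 : ℝ) / 6)) • b q) with hS₁
  set S₂ : E := ∑ q ∈ (Ioc Q X).filter P, (μ q : ℝ) • N q X with hS₂
  set Sa : E := ∑ q ∈ (Icc 1 Q).filter P, (μ q : ℝ) • a q with hSa
  set Sb : E := ∑ q ∈ (Icc 1 Q).filter P, (μ q : ℝ) • b q with hSb
  have hdecomp : F X - (X : ℝ) • A - ((X : ℝ) ^ ((5 : ℝ) / 6)) • B =
      S₁ + S₂ + (X : ℝ) • (Sa - A) + ((X : ℝ) ^ ((5 : ℝ) / 6)) • (Sb - B) := by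
    have hS₁' : S₁ = (∑ q ∈ (Icc 1 Q).filter P, (μ q : ℝ) • N q X) - (X : ℝ) • Sa
        - ((X : ℝ) ^ ((5 : ℝ) / 6)) • Sb := by
      simp only [hS₁, hSa, hSb, smul_sub, Finset.sum_sub_distrib, Finset.smul_sum]
      congr 1
      · congr 1
        exact Finset.sum_congr rfl fun q _ => smul_comm _ _ _
      · exact Finset.sum_congr rfl fun q _ => smul_comm _ _ _
    rw [hF X hX, sum_Icc_filter_split P _ hQX, hS₁', smul_sub, smul_sub]
    abel
  -- bounds
  have hT₁ : ‖S₁‖ ≤ 5 * max C₁ 0 * x ^ ((18 : ℝ) / 23 + ε) := by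
    have h := hC₁ X Q hX hQ1 hQ14
    have hsum : x ^ ((17 : ℝ) / 24) + (Q : ℝ) ^ ((15 : ℝ) / 8) * x ^ ((3 : ℝ) / 8)
        + (Q : ℝ) ^ ((7 : ℝ) / 2) + x / Q ≤ 5 * x ^ ((18 : ℝ) / 23) := by
      have e1 := tt_exp_bound₁ hx1 hQpos.le hQle
      have e2 := tt_exp_bound₂ hx1 hQpos.le hQle
      have e3 := tt_exp_bound₃ hx1 hQge
      have e5 := tt_exp_bound₅ hx1
      linarith
    have hnn : 0 ≤ x ^ ((17 : ℝ) / 24) + (Q : ℝ) ^ ((15 : ℝ) / 8) * x ^ ((3 : ℝ) / 8)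
        + (Q : ℝ) ^ ((7 : ℝ) / 2) + x / Q := by positivity
    calc ‖S₁‖ ≤ C₁ * x ^ ε * (x ^ ((17 : ℝ) / 24) + (Q : ℝ) ^ ((15 : ℝ) / 8) * x ^ ((3 : ℝ) / 8)
          + (Q : ℝ) ^ ((7 : ℝ) / 2) + x / Q) := h
      _ ≤ max C₁ 0 * x ^ ε * (x ^ ((17 : ℝ) / 24) + (Q : ℝ) ^ ((15 : ℝ) / 8) * x ^ ((3 : ℝ) / 8)
          + (Q : ℝ) ^ ((7 : ℝ) / 2) + x / Q) := by
          gcongr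
          exact le_max_left _ _
      _ ≤ max C₁ 0 * x ^ ε * (5 * x ^ ((18 : ℝ) / 23)) := by
          gcongr
      _ = 5 * max C₁ 0 * x ^ ((18 : ℝ) / 23 + ε) := by rw [hmain]; ring
  have hT₂ : ‖S₂‖ ≤ 2 * max C₂ 0 * x ^ ((18 : ℝ) / 23 + ε) := by
    have h := norm_sum_Ioc_moebius_smul_le P (le_max_right C₂ 0) hε.le hQ1 hQX (N := fun q => N q X)
      (fun q hQq hqX hP hsq => (hC₂ X q hX (by omega) hqX hP hsq).trans (by
        gcongr
        exact le_max_left _ _))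
    have e3 := tt_exp_bound₃ hx1 hQge
    calc ‖S₂‖ ≤ max C₂ 0 * x ^ ε * x / Q := h
      _ = max C₂ 0 * x ^ ε * (x / Q) := by ring
      _ ≤ max C₂ 0 * x ^ ε * (2 * x ^ ((18 : ℝ) / 23)) := by gcongr
      _ = 2 * max C₂ 0 * x ^ ((18 : ℝ) / 23 + ε) := by rw [hmain]; ring
  have hT₃ : ‖(X : ℝ) • (Sa - A)‖ ≤ 2 * max C₃ 0 * x ^ ((18 : ℝ) / 23 + ε) := by
    have h := hC₃ Q hQ1
    rw [norm_smul, Real.norm_eq_abs, abs_of_pos hxpos, norm_sub_rev]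
    have hQε : (Q : ℝ) ^ ε ≤ x ^ ε := Real.rpow_le_rpow hQpos.le hQx hε.le
    have e3 := tt_exp_bound₃ hx1 hQge
    calc x * ‖A - Sa‖ ≤ x * (C₃ * (Q : ℝ) ^ ε / Q) := by gcongr
      _ ≤ x * (max C₃ 0 * x ^ ε / Q) := by
          gcongr
          exact le_max_left _ _
      _ = max C₃ 0 * x ^ ε * (x / Q) := by ring
      _ ≤ max C₃ 0 * x ^ ε * (2 * x ^ ((18 : ℝ) / 23)) := by gcongr
      _ = 2 * max C₃ 0 * x ^ ((18 : ℝ) / 23 + ε) := by rw [hmain]; ring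
  have hT₄ : ‖((X : ℝ) ^ ((5 : ℝ) / 6)) • (Sb - B)‖ ≤ 2 * max C₄ 0 * x ^ ((18 : ℝ) / 23 + ε) := by
    have h := hC₄ Q hQ1
    have h56 : 0 < x ^ ((5 : ℝ) / 6) := Real.rpow_pos_of_pos hxpos _
    rw [norm_smul, Real.norm_eq_abs, abs_of_pos h56, norm_sub_rev]
    have hQε : (Q : ℝ) ^ ε ≤ x ^ ε := Real.rpow_le_rpow hQpos.le hQx hε.le
    have hq23 : 0 < (Q : ℝ) ^ ((2 : ℝ) / 3) := Real.rpow_pos_of_pos hQpos _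
    have e4 := tt_exp_bound₄ hx1 hQpos hQge
    calc x ^ ((5 : ℝ) / 6) * ‖B - Sb‖ ≤ x ^ ((5 : ℝ) / 6) * (C₄ * (Q : ℝ) ^ ε / (Q : ℝ) ^ ((2 : ℝ) / 3)) := by
          gcongr
      _ ≤ x ^ ((5 : ℝ) / 6) * (max C₄ 0 * x ^ ε / (Q : ℝ) ^ ((2 : ℝ) / 3)) := by
          gcongr
          exact le_max_left _ _
      _ = max C₄ 0 * x ^ ε * (x ^ ((5 : ℝ) / 6) / (Q : ℝ) ^ ((2 : ℝ) / 3)) := by ring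
      _ ≤ max C₄ 0 * x ^ ε * (2 * x ^ ((18 : ℝ) / 23)) := by gcongr
      _ = 2 * max C₄ 0 * x ^ ((18 : ℝ) / 23 + ε) := by rw [hmain]; ring
  rw [hdecomp]
  calc ‖S₁ + S₂ + (X : ℝ) • (Sa - A) + ((X : ℝ) ^ ((5 : ℝ) / 6)) • (Sb - B)‖
      ≤ ‖S₁‖ + ‖S₂‖ + ‖(X : ℝ) • (Sa - A)‖ + ‖((X : ℝ) ^ ((5 : ℝ) / 6)) • (Sb - B)‖ := by
        refine (norm_add_le _ _).trans ?_
        refine add_le_add ((norm_add_le _ _).trans (add_le_add (norm_add_le _ _) le_rfl)) le_rfl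
    _ ≤ 5 * max C₁ 0 * x ^ ((18 : ℝ) / 23 + ε) + 2 * max C₂ 0 * x ^ ((18 : ℝ) / 23 + ε)
        + 2 * max C₃ 0 * x ^ ((18 : ℝ) / 23 + ε) + 2 * max C₄ 0 * x ^ ((18 : ℝ) / 23 + ε) := by
        gcongr
    _ = (5 * max C₁ 0 + 2 * max C₂ 0 + 2 * max C₃ 0 + 2 * max C₄ 0) * x ^ ((18 : ℝ) / 23 + ε) := by
        ring

/-! ### `6^{ω(q)} ≪ q^δ` and the uniformity input from `btt_uniformity_sqDvd` -/

/-- **`K^{ω(q)} ≤ C_δ q^δ`** (`ω(q)` = number of prime factors): primes `p ≥ K^{1/δ}` have `K ≤ p^δ`,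
and there are boundedly many smaller ones. [folklore] -/
theorem pow_card_primeFactors_le_rpow {K : ℝ} (hK : 1 ≤ K) {δ : ℝ} (hδ : 0 < δ) :
    ∃ C : ℝ, 0 < C ∧ ∀ q : ℕ, 1 ≤ q → K ^ q.primeFactors.card ≤ C * (q : ℝ) ^ δ := by
  set B : ℕ := ⌈K ^ (1 / δ)⌉₊ + 1 with hB
  have hK0 : 0 ≤ K := zero_le_one.trans hK
  refine ⟨K ^ B, by positivity, fun q hq => ?_⟩
  classical
  set S := q.primeFactors with hS
  set S₁ := S.filter (fun p => p < B) with hS₁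
  set S₂ := S.filter (fun p => ¬ p < B) with hS₂
  have hcard : S.card = S₁.card + S₂.card := (Finset.card_filter_add_card_filter_not _).symm
  -- small primes
  have h1 : K ^ S₁.card ≤ K ^ B := by
    refine pow_le_pow_right₀ hK ?_
    calc S₁.card ≤ (Finset.range B).card := Finset.card_le_card fun p hp => by
          rw [Finset.mem_range]; exact (Finset.mem_filter.1 hp).2
      _ = B := Finset.card_range B
  -- large primes: `K ≤ p ^ δ`
  have hlarge : ∀ p ∈ S₂, K ≤ (p : ℝ) ^ δ := by
    intro p hp
    have hpB : B ≤ p := not_lt.1 (Finset.mem_filter.1 hp).2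
    have hKp : K ^ (1 / δ) ≤ (p : ℝ) := by
      have h1 : K ^ (1 / δ) ≤ (⌈K ^ (1 / δ)⌉₊ : ℝ) := Nat.le_ceil _
      have h2 : ((⌈K ^ (1 / δ)⌉₊ : ℕ) : ℝ) + 1 ≤ (p : ℝ) := by exact_mod_cast hpB
      linarith
    calc K = (K ^ (1 / δ)) ^ δ := by
          rw [← Real.rpow_mul hK0, one_div, inv_mul_cancel₀ hδ.ne', Real.rpow_one]
      _ ≤ (p : ℝ) ^ δ := Real.rpow_le_rpow (by positivity) hKp hδ.le
  have h2 : K ^ S₂.card ≤ (q : ℝ) ^ δ := by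
    calc K ^ S₂.card = ∏ p ∈ S₂, K := by rw [Finset.prod_const]
      _ ≤ ∏ p ∈ S₂, (p : ℝ) ^ δ := Finset.prod_le_prod (fun _ _ => hK0) hlarge
      _ = (∏ p ∈ S₂, (p : ℝ)) ^ δ := Real.finsetProd_rpow _ _ (fun _ _ => by positivity) δ
      _ ≤ (q : ℝ) ^ δ := by
          refine Real.rpow_le_rpow (Finset.prod_nonneg fun _ _ => by positivity) ?_ hδ.le
          have hdvd : ∏ p ∈ S₂, p ∣ q :=
            (Finset.prod_dvd_prod_of_subset _ _ _ (Finset.filter_subset _ _)).trans (Nat.prod_primeFactors_dvd q)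
          have hle : ∏ p ∈ S₂, p ≤ q := Nat.le_of_dvd (by omega) hdvd
          rw [← Nat.cast_prod]
          exact_mod_cast hle
  calc K ^ S.card = K ^ S₁.card * K ^ S₂.card := by rw [hcard, pow_add]
    _ ≤ K ^ B * (q : ℝ) ^ δ := mul_le_mul h1 h2 (by positivity) (by positivity)

/-- The irreducible orbits of discriminant `D ≠ 0` are at most all orbits: `#irredOrbitsOfDisc D ≤ h(D)`. [folklore] -/
theorem card_irredOrbitsOfDisc_le_classNumber {D : ℤ} (hD : D ≠ 0) :
    Nat.card (irredOrbitsOfDisc D) ≤ classNumber D := by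
  unfold classNumber
  rw [Nat.card_coe_set_eq, Nat.card_coe_set_eq]
  refine Set.ncard_le_ncard ?_ (orbitsOfDisc_finite hD)
  rintro O ⟨f, rfl, -, hf⟩
  exact ⟨f, rfl, hf⟩

/-- **Uniformity for the level-`q` type counts** from (the body of) `btt_uniformity_sqDvd`: the
irreducible orbits with `Disc` in the window, in the type class and divisible by `q²` are among ALL
orbits with `q² ∣ Disc` in the window, counted with `h(D)` (BTT (22)); so
`N^±_q(X; T) ≤ C 6^{ω(q)} X/q²` for squarefree `q`. [cite: BhargavaTaniguchiThorne2023, Proposition 4.5] -/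
theorem irredOrbitCount_sqDvd_le_of_uniformity {C : ℝ}
    (hC : ∀ q : ℕ, Squarefree q → ∀ s : ℤ, (s = 1 ∨ s = -1) → ∀ X : ℕ,
      (((∑ D ∈ (discWindow s X).filter (fun D => (q : ℤ) ^ 2 ∣ D), classNumber D : ℕ) : ℝ))
        ≤ C * 6 ^ q.primeFactors.card * X / (q : ℝ) ^ 2)
    {s : ℤ} (hs : s = 1 ∨ s = -1) (T : ℤ → Prop) [DecidablePred T] {q : ℕ} (hq : Squarefree q) (X : ℕ) :
    (irredOrbitCount s {f : BinaryCubic ℤ | T f.disc ∧ (q : ℤ) ^ 2 ∣ f.disc} X : ℝ)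
      ≤ C * 6 ^ q.primeFactors.card * X / (q : ℝ) ^ 2 := by
  classical
  refine le_trans ?_ (hC q hq s hs X)
  rw [irredOrbitCount_setOf_disc_eq_sum hs (fun D => T D ∧ (q : ℤ) ^ 2 ∣ D) X]
  push_cast
  calc ∑ D ∈ (discWindow s X).filter (fun D => T D ∧ (q : ℤ) ^ 2 ∣ D), (Nat.card (irredOrbitsOfDisc D) : ℝ)
      ≤ ∑ D ∈ (discWindow s X).filter (fun D => T D ∧ (q : ℤ) ^ 2 ∣ D), (classNumber D : ℝ) := by
        refine Finset.sum_le_sum fun D hD => ?_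
        have hD0 : D ≠ 0 := fun h => zero_not_mem_discWindow hs X (h ▸ (Finset.mem_filter.1 hD).1)
        exact_mod_cast card_irredOrbitsOfDisc_le_classNumber hD0
    _ ≤ ∑ D ∈ (discWindow s X).filter (fun D => (q : ℤ) ^ 2 ∣ D), (classNumber D : ℝ) := by
        refine Finset.sum_le_sum_of_subset_of_nonneg ?_ fun _ _ _ => by positivity
        intro D hD
        rw [Finset.mem_filter] at hD ⊢
        exact ⟨hD.1, hD.2.2⟩

/-- Hence, assuming `btt_uniformity_sqDvd`: for every `ε > 0` there is `C` with
`N^±_q(X; T) ≤ C q^ε X/q²` for all squarefree `q ≥ 1`, both signs, all `X` and every discriminant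
condition `T` (`6^{ω(q)} ≤ C_ε q^ε`). [cite: BhargavaTaniguchiThorne2023, Proposition 4.5] -/
theorem irredOrbitCount_sqDvd_le_rpow (hU : btt_uniformity_sqDvd) {ε : ℝ} (hε : 0 < ε) :
    ∃ C : ℝ, 0 ≤ C ∧ ∀ s : ℤ, (s = 1 ∨ s = -1) → ∀ (T : ℤ → Prop) [DecidablePred T] (q : ℕ), 1 ≤ q →
      Squarefree q → ∀ X : ℕ,
      (irredOrbitCount s {f : BinaryCubic ℤ | T f.disc ∧ (q : ℤ) ^ 2 ∣ f.disc} X : ℝ)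
        ≤ C * (q : ℝ) ^ ε * (X : ℝ) / (q : ℝ) ^ 2 := by
  obtain ⟨C, hC⟩ := hU
  obtain ⟨C', hC'0, hC'⟩ := pow_card_primeFactors_le_rpow (K := 6) (by norm_num) hε
  refine ⟨max C 0 * C', by positivity, fun s hs T _ q hq hsq X => ?_⟩
  have h1 := irredOrbitCount_sqDvd_le_of_uniformity hC hs T hsq X
  have hq0 : (0 : ℝ) < q := by exact_mod_cast hq
  calc (irredOrbitCount s {f : BinaryCubic ℤ | T f.disc ∧ (q : ℤ) ^ 2 ∣ f.disc} X : ℝ)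
      ≤ C * 6 ^ q.primeFactors.card * X / (q : ℝ) ^ 2 := h1
    _ ≤ max C 0 * 6 ^ q.primeFactors.card * X / (q : ℝ) ^ 2 := by
        gcongr
        exact le_max_left _ _
    _ ≤ max C 0 * (C' * (q : ℝ) ^ ε) * X / (q : ℝ) ^ 2 := by
        gcongr
        exact hC' q hq
    _ = max C 0 * C' * (q : ℝ) ^ ε * (X : ℝ) / (q : ℝ) ^ 2 := by ring

/-! ### The counts of each `2`-adic type from the analytic core -/

/-- **Two-term count of irreducible orbits of fundamental discriminant in a `2`-adic type, imaginary
side, from the analytic core.** For an admissible type `(r, s)`, write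
`N⁻_q(X) = irredOrbitCount (-1) {f | Disc f ≡ rs (8r), q² ∣ Disc f} X`. Assume `btt_uniformity_sqDvd`
and, for residue data `a_q, b_q` (the residues at `s = 1, 5/6` of the level-`q` Shintani zeta
function with the local specification at `2`) and their Euler products `A, B`: the core bound `hcore`
of Taniguchi–Thorne §6.1 for `1 ≤ Q ≤ X^{1/4}` and the completion estimates `ha`, `hb`. Then
`Σ_{−X<D<0 fund., D ≡ rs (8r)} #irredOrbitsOfDisc D = A X + B X^{5/6} + O_ε(X^{18/23+ε})`.
[cite: TaniguchiThorne2013, §6.1 with §6.3 (proof of Theorems 2 and 4: sieve, truncation, Q = X^{5/23})] -/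
theorem tt_typeCount_neg_of_core (hU : btt_uniformity_sqDvd) {r : ℕ} {s : ℤ}
    (hr : r ∈ ({1, 4, 8} : Finset ℕ)) (hs : s ∈ ({1, 3, 5, 7} : Finset ℤ))
    (he : ttLocalFactorTwo (r * s) = 1) {a b : ℕ → ℝ} {A B : ℝ}
    (hcore : ∀ ε : ℝ, 0 < ε → ∃ C : ℝ, ∀ X Q : ℕ, 1 ≤ X → 1 ≤ Q → (Q : ℝ) ≤ (X : ℝ) ^ ((1 : ℝ) / 4) →
      |∑ q ∈ (Icc 1 Q).filter (fun q => ¬ 2 ∣ q), (μ q : ℝ) *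
          ((irredOrbitCount (-1)
              {f : BinaryCubic ℤ | f.disc ≡ r * s [ZMOD ((8 * r : ℕ) : ℤ)] ∧ (q : ℤ) ^ 2 ∣ f.disc} X : ℝ)
            - (X : ℝ) * a q - (X : ℝ) ^ ((5 : ℝ) / 6) * b q)|
        ≤ C * (X : ℝ) ^ ε * ((X : ℝ) ^ ((17 : ℝ) / 24) + (Q : ℝ) ^ ((15 : ℝ) / 8) * (X : ℝ) ^ ((3 : ℝ) / 8)
            + (Q : ℝ) ^ ((7 : ℝ) / 2) + (X : ℝ) / Q))
    (ha : ∀ ε : ℝ, 0 < ε → ∃ C : ℝ, ∀ Q : ℕ, 1 ≤ Q →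
      |A - ∑ q ∈ (Icc 1 Q).filter (fun q => ¬ 2 ∣ q), (μ q : ℝ) * a q| ≤ C * (Q : ℝ) ^ ε / Q)
    (hb : ∀ ε : ℝ, 0 < ε → ∃ C : ℝ, ∀ Q : ℕ, 1 ≤ Q →
      |B - ∑ q ∈ (Icc 1 Q).filter (fun q => ¬ 2 ∣ q), (μ q : ℝ) * b q| ≤ C * (Q : ℝ) ^ ε / (Q : ℝ) ^ ((2 : ℝ) / 3)) :
    ∀ ε : ℝ, 0 < ε → ∃ C : ℝ, ∀ X : ℕ, 1 ≤ X →
      |(∑ D ∈ (negFundDiscrs X).filter (fun D => D ≡ r * s [ZMOD ((8 * r : ℕ) : ℤ)]),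
          (Nat.card (irredOrbitsOfDisc D) : ℝ)) - A * X - B * (X : ℝ) ^ ((5 : ℝ) / 6)|
        ≤ C * (X : ℝ) ^ ((18 : ℝ) / 23 + ε) := by
  classical
  have h := tt_sieve_assembly (E := ℝ) (fun q => ¬ 2 ∣ q)
    (F := fun X => ∑ D ∈ (negFundDiscrs X).filter (fun D => D ≡ r * s [ZMOD ((8 * r : ℕ) : ℤ)]),
      (Nat.card (irredOrbitsOfDisc D) : ℝ))
    (N := fun q X => (irredOrbitCount (-1)
      {f : BinaryCubic ℤ | f.disc ≡ r * s [ZMOD ((8 * r : ℕ) : ℤ)] ∧ (q : ℤ) ^ 2 ∣ f.disc} X : ℝ))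
    (a := a) (b := b) (A := A) (B := B) ?_ ?_ ?_ ?_ ?_
  · intro ε hε
    obtain ⟨C, hC⟩ := h ε hε
    refine ⟨C, fun X hX => ?_⟩
    have h1 := hC X hX
    rw [Real.norm_eq_abs, smul_eq_mul, smul_eq_mul] at h1
    rwa [mul_comm A, mul_comm B]
  · intro X _
    have hid := sum_negFundDiscrs_type_irredOrbits_eq_sum_moebius hr hs he X
    have hid' := congrArg (fun z : ℤ => (z : ℝ)) hid
    simp only [Int.cast_sum, Int.cast_mul, Int.cast_natCast] at hid'
    simpa only [smul_eq_mul] using hid'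
  · intro ε hε
    obtain ⟨C, hC⟩ := hcore ε hε
    refine ⟨C, fun X Q hX hQ hQ4 => ?_⟩
    have h1 := hC X Q hX hQ hQ4
    simpa only [smul_eq_mul, Real.norm_eq_abs] using h1
  · intro ε hε
    obtain ⟨C, -, hC⟩ := irredOrbitCount_sqDvd_le_rpow hU hε
    refine ⟨C, fun X q _ hq _ _ hsq => ?_⟩
    rw [Real.norm_eq_abs, abs_of_nonneg (Nat.cast_nonneg _)]
    exact hC (-1) (Or.inr rfl) (fun D => D ≡ r * s [ZMOD ((8 * r : ℕ) : ℤ)]) q hq hsq X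
  · intro ε hε
    obtain ⟨C, hC⟩ := ha ε hε
    exact ⟨C, fun Q hQ => by simpa only [smul_eq_mul, Real.norm_eq_abs] using hC Q hQ⟩
  · intro ε hε
    obtain ⟨C, hC⟩ := hb ε hε
    exact ⟨C, fun Q hQ => by simpa only [smul_eq_mul, Real.norm_eq_abs] using hC Q hQ⟩

/-- **The same on the real side** (`N⁺_q(X) = irredOrbitCount 1 {f | Disc f ≡ rs (8r), q² ∣ Disc f} X`).
[cite: TaniguchiThorne2013, §6.1 with §6.3 (proof of Theorems 2 and 4: sieve, truncation, Q = X^{5/23})] -/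
theorem tt_typeCount_pos_of_core (hU : btt_uniformity_sqDvd) {r : ℕ} {s : ℤ}
    (hr : r ∈ ({1, 4, 8} : Finset ℕ)) (hs : s ∈ ({1, 3, 5, 7} : Finset ℤ))
    (he : ttLocalFactorTwo (r * s) = 1) {a b : ℕ → ℝ} {A B : ℝ}
    (hcore : ∀ ε : ℝ, 0 < ε → ∃ C : ℝ, ∀ X Q : ℕ, 1 ≤ X → 1 ≤ Q → (Q : ℝ) ≤ (X : ℝ) ^ ((1 : ℝ) / 4) →
      |∑ q ∈ (Icc 1 Q).filter (fun q => ¬ 2 ∣ q), (μ q : ℝ) *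
          ((irredOrbitCount 1
              {f : BinaryCubic ℤ | f.disc ≡ r * s [ZMOD ((8 * r : ℕ) : ℤ)] ∧ (q : ℤ) ^ 2 ∣ f.disc} X : ℝ)
            - (X : ℝ) * a q - (X : ℝ) ^ ((5 : ℝ) / 6) * b q)|
        ≤ C * (X : ℝ) ^ ε * ((X : ℝ) ^ ((17 : ℝ) / 24) + (Q : ℝ) ^ ((15 : ℝ) / 8) * (X : ℝ) ^ ((3 : ℝ) / 8)
            + (Q : ℝ) ^ ((7 : ℝ) / 2) + (X : ℝ) / Q))
    (ha : ∀ ε : ℝ, 0 < ε → ∃ C : ℝ, ∀ Q : ℕ, 1 ≤ Q →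
      |A - ∑ q ∈ (Icc 1 Q).filter (fun q => ¬ 2 ∣ q), (μ q : ℝ) * a q| ≤ C * (Q : ℝ) ^ ε / Q)
    (hb : ∀ ε : ℝ, 0 < ε → ∃ C : ℝ, ∀ Q : ℕ, 1 ≤ Q →
      |B - ∑ q ∈ (Icc 1 Q).filter (fun q => ¬ 2 ∣ q), (μ q : ℝ) * b q| ≤ C * (Q : ℝ) ^ ε / (Q : ℝ) ^ ((2 : ℝ) / 3)) :
    ∀ ε : ℝ, 0 < ε → ∃ C : ℝ, ∀ X : ℕ, 1 ≤ X →
      |(∑ D ∈ (posFundDiscrs X).filter (fun D => D ≡ r * s [ZMOD ((8 * r : ℕ) : ℤ)]),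
          (Nat.card (irredOrbitsOfDisc D) : ℝ)) - A * X - B * (X : ℝ) ^ ((5 : ℝ) / 6)|
        ≤ C * (X : ℝ) ^ ((18 : ℝ) / 23 + ε) := by
  classical
  have h := tt_sieve_assembly (E := ℝ) (fun q => ¬ 2 ∣ q)
    (F := fun X => ∑ D ∈ (posFundDiscrs X).filter (fun D => D ≡ r * s [ZMOD ((8 * r : ℕ) : ℤ)]),
      (Nat.card (irredOrbitsOfDisc D) : ℝ))
    (N := fun q X => (irredOrbitCount 1
      {f : BinaryCubic ℤ | f.disc ≡ r * s [ZMOD ((8 * r : ℕ) : ℤ)] ∧ (q : ℤ) ^ 2 ∣ f.disc} X : ℝ))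
    (a := a) (b := b) (A := A) (B := B) ?_ ?_ ?_ ?_ ?_
  · intro ε hε
    obtain ⟨C, hC⟩ := h ε hε
    refine ⟨C, fun X hX => ?_⟩
    have h1 := hC X hX
    rw [Real.norm_eq_abs, smul_eq_mul, smul_eq_mul] at h1
    rwa [mul_comm A, mul_comm B]
  · intro X _
    have hid := sum_posFundDiscrs_type_irredOrbits_eq_sum_moebius hr hs he X
    have hid' := congrArg (fun z : ℤ => (z : ℝ)) hid
    simp only [Int.cast_sum, Int.cast_mul, Int.cast_natCast] at hid'
    simpa only [smul_eq_mul] using hid'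
  · intro ε hε
    obtain ⟨C, hC⟩ := hcore ε hε
    refine ⟨C, fun X Q hX hQ hQ4 => ?_⟩
    have h1 := hC X Q hX hQ hQ4
    simpa only [smul_eq_mul, Real.norm_eq_abs] using h1
  · intro ε hε
    obtain ⟨C, -, hC⟩ := irredOrbitCount_sqDvd_le_rpow hU hε
    refine ⟨C, fun X q _ hq _ _ hsq => ?_⟩
    rw [Real.norm_eq_abs, abs_of_nonneg (Nat.cast_nonneg _)]
    exact hC 1 (Or.inl rfl) (fun D => D ≡ r * s [ZMOD ((8 * r : ℕ) : ℤ)]) q hq hsq X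
  · intro ε hε
    obtain ⟨C, hC⟩ := ha ε hε
    exact ⟨C, fun Q hQ => by simpa only [smul_eq_mul, Real.norm_eq_abs] using hC Q hQ⟩
  · intro ε hε
    obtain ⟨C, hC⟩ := hb ε hε
    exact ⟨C, fun Q hQ => by simpa only [smul_eq_mul, Real.norm_eq_abs] using hC Q hQ⟩

/-! ### The twisted sums of each `2`-adic type from the analytic core (no main terms: `ψ⁶ ≠ 1`) -/

/-- The level-`q` twisted sums are bounded by the level-`q` counts (`‖ψ‖ ≤ 1`). [folklore] -/
theorem norm_sum_twist_le_irredOrbitCount {s : ℤ} (hs : s = 1 ∨ s = -1) (T : ℤ → Prop) [DecidablePred T]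
    {n : ℕ} (ψ : DirichletCharacter ℂ n) (g : ℤ → ℤ) (q : ℕ) (X : ℕ) :
    ‖∑ D ∈ (discWindow s X).filter (fun D => T D ∧ (q : ℤ) ^ 2 ∣ D),
        ψ ((g D : ℤ) : ZMod n) * (Nat.card (irredOrbitsOfDisc D) : ℂ)‖
      ≤ (irredOrbitCount s {f : BinaryCubic ℤ | T f.disc ∧ (q : ℤ) ^ 2 ∣ f.disc} X : ℝ) := by
  classical
  rw [irredOrbitCount_setOf_disc_eq_sum hs (fun D => T D ∧ (q : ℤ) ^ 2 ∣ D) X]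
  push_cast
  refine (norm_sum_le _ _).trans (Finset.sum_le_sum fun D _ => ?_)
  rw [norm_mul, Complex.norm_natCast]
  calc ‖ψ ((g D : ℤ) : ZMod n)‖ * (Nat.card (irredOrbitsOfDisc D) : ℝ)
      ≤ 1 * (Nat.card (irredOrbitsOfDisc D) : ℝ) := by
        gcongr
        exact DirichletCharacter.norm_le_one ψ _
    _ = (Nat.card (irredOrbitsOfDisc D) : ℝ) := one_mul _

/-- **Twisted sums of a `2`-adic type, imaginary side, from the analytic core** (Taniguchi–Thorne
Thm 25 for `M₃⁻(X, 𝒮₂; r, ψ)`, `ψ⁶ ≠ 1`: "a straightforward combination of the proofs of Theorems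
(2) and (22)", the orbital `L`-functions being entire so that no residual terms occur). With the
level-`q` twisted sums `N⁻_q(X, ψ) = Σ_{−X<D<0, D ≡ rs (8r), q² ∣ D} ψ(D/r) #irredOrbitsOfDisc D`, assume
`btt_uniformity_sqDvd` and the core bound `‖Σ_{q ≤ Q odd} μ(q) N⁻_q(X, ψ)‖ ≤ C_ε X^ε (X^{17/24} +
Q^{15/8}X^{3/8} + Q^{7/2} + X/Q)` for `1 ≤ Q ≤ X^{1/4}`. Then
`‖Σ_{−X<D<0 fund., D ≡ rs (8r)} ψ(D/r) #irredOrbitsOfDisc D‖ = O_ε(X^{18/23+ε})`.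
[cite: TaniguchiThorne2013, Theorem 25 with §6.1 (sieve, truncation, Q = X^{5/23})] -/
theorem tt_typeTwist_neg_of_core (hU : btt_uniformity_sqDvd) {r : ℕ} {s : ℤ}
    (hr : r ∈ ({1, 4, 8} : Finset ℕ)) (hs : s ∈ ({1, 3, 5, 7} : Finset ℤ))
    (he : ttLocalFactorTwo (r * s) = 1) {n : ℕ} (ψ : DirichletCharacter ℂ n)
    (hcore : ∀ ε : ℝ, 0 < ε → ∃ C : ℝ, ∀ X Q : ℕ, 1 ≤ X → 1 ≤ Q → (Q : ℝ) ≤ (X : ℝ) ^ ((1 : ℝ) / 4) →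
      ‖∑ q ∈ (Icc 1 Q).filter (fun q => ¬ 2 ∣ q), (μ q : ℂ) *
          ∑ D ∈ (discWindow (-1) X).filter
            (fun D => D ≡ r * s [ZMOD ((8 * r : ℕ) : ℤ)] ∧ (q : ℤ) ^ 2 ∣ D),
            ψ (((D / (r : ℤ) : ℤ)) : ZMod n) * (Nat.card (irredOrbitsOfDisc D) : ℂ)‖
        ≤ C * (X : ℝ) ^ ε * ((X : ℝ) ^ ((17 : ℝ) / 24) + (Q : ℝ) ^ ((15 : ℝ) / 8) * (X : ℝ) ^ ((3 : ℝ) / 8)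
            + (Q : ℝ) ^ ((7 : ℝ) / 2) + (X : ℝ) / Q)) :
    ∀ ε : ℝ, 0 < ε → ∃ C : ℝ, ∀ X : ℕ, 1 ≤ X →
      ‖∑ D ∈ (negFundDiscrs X).filter (fun D => D ≡ r * s [ZMOD ((8 * r : ℕ) : ℤ)]),
          ψ (((D / (r : ℤ) : ℤ)) : ZMod n) * (Nat.card (irredOrbitsOfDisc D) : ℂ)‖
        ≤ C * (X : ℝ) ^ ((18 : ℝ) / 23 + ε) := by
  classical
  have h := tt_sieve_assembly (E := ℂ) (fun q => ¬ 2 ∣ q)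
    (F := fun X => ∑ D ∈ (negFundDiscrs X).filter (fun D => D ≡ r * s [ZMOD ((8 * r : ℕ) : ℤ)]),
      ψ (((D / (r : ℤ) : ℤ)) : ZMod n) * (Nat.card (irredOrbitsOfDisc D) : ℂ))
    (N := fun q X => ∑ D ∈ (discWindow (-1) X).filter
        (fun D => D ≡ r * s [ZMOD ((8 * r : ℕ) : ℤ)] ∧ (q : ℤ) ^ 2 ∣ D),
        ψ (((D / (r : ℤ) : ℤ)) : ZMod n) * (Nat.card (irredOrbitsOfDisc D) : ℂ))
    (a := fun _ => 0) (b := fun _ => 0) (A := 0) (B := 0) ?_ ?_ ?_ ?_ ?_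
  · intro ε hε
    obtain ⟨C, hC⟩ := h ε hε
    refine ⟨C, fun X hX => ?_⟩
    simpa only [smul_zero, sub_zero] using hC X hX
  · intro X _
    have hid := sum_negFundDiscrs_type_eq_sum_moebius (R := ℂ) hr hs he
      (fun D => ψ (((D / (r : ℤ) : ℤ)) : ZMod n) * (Nat.card (irredOrbitsOfDisc D) : ℂ)) X
    simp only [Complex.real_smul, Complex.ofReal_intCast]
    exact hid
  · intro ε hε
    obtain ⟨C, hC⟩ := hcore ε hε
    refine ⟨C, fun X Q hX hQ hQ4 => ?_⟩
    simpa only [smul_zero, sub_zero, Complex.real_smul, Complex.ofReal_intCast] using hC X Q hX hQ hQ4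
  · intro ε hε
    obtain ⟨C, -, hC⟩ := irredOrbitCount_sqDvd_le_rpow hU hε
    refine ⟨C, fun X q _ hq _ _ hsq => ?_⟩
    exact (norm_sum_twist_le_irredOrbitCount (Or.inr rfl) _ ψ (fun D => D / (r : ℤ)) q X).trans
      (hC (-1) (Or.inr rfl) (fun D => D ≡ r * s [ZMOD ((8 * r : ℕ) : ℤ)]) q hq hsq X)
  · exact fun ε _ => ⟨0, fun Q _ => by simp⟩
  · exact fun ε _ => ⟨0, fun Q _ => by simp⟩

/-- **The same on the real side** (`N⁺_q(X, ψ)` over `0 < D < X`; `D = 1` carries no irreducible orbit).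
[cite: TaniguchiThorne2013, Theorem 25 with §6.1 (sieve, truncation, Q = X^{5/23})] -/
theorem tt_typeTwist_pos_of_core (hU : btt_uniformity_sqDvd) {r : ℕ} {s : ℤ}
    (hr : r ∈ ({1, 4, 8} : Finset ℕ)) (hs : s ∈ ({1, 3, 5, 7} : Finset ℤ))
    (he : ttLocalFactorTwo (r * s) = 1) {n : ℕ} (ψ : DirichletCharacter ℂ n)
    (hcore : ∀ ε : ℝ, 0 < ε → ∃ C : ℝ, ∀ X Q : ℕ, 1 ≤ X → 1 ≤ Q → (Q : ℝ) ≤ (X : ℝ) ^ ((1 : ℝ) / 4) →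
      ‖∑ q ∈ (Icc 1 Q).filter (fun q => ¬ 2 ∣ q), (μ q : ℂ) *
          ∑ D ∈ (discWindow 1 X).filter
            (fun D => D ≡ r * s [ZMOD ((8 * r : ℕ) : ℤ)] ∧ (q : ℤ) ^ 2 ∣ D),
            ψ (((D / (r : ℤ) : ℤ)) : ZMod n) * (Nat.card (irredOrbitsOfDisc D) : ℂ)‖
        ≤ C * (X : ℝ) ^ ε * ((X : ℝ) ^ ((17 : ℝ) / 24) + (Q : ℝ) ^ ((15 : ℝ) / 8) * (X : ℝ) ^ ((3 : ℝ) / 8)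
            + (Q : ℝ) ^ ((7 : ℝ) / 2) + (X : ℝ) / Q)) :
    ∀ ε : ℝ, 0 < ε → ∃ C : ℝ, ∀ X : ℕ, 1 ≤ X →
      ‖∑ D ∈ (posFundDiscrs X).filter (fun D => D ≡ r * s [ZMOD ((8 * r : ℕ) : ℤ)]),
          ψ (((D / (r : ℤ) : ℤ)) : ZMod n) * (Nat.card (irredOrbitsOfDisc D) : ℂ)‖
        ≤ C * (X : ℝ) ^ ((18 : ℝ) / 23 + ε) := by
  classical
  have h := tt_sieve_assembly (E := ℂ) (fun q => ¬ 2 ∣ q)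
    (F := fun X => ∑ D ∈ (posFundDiscrs X).filter (fun D => D ≡ r * s [ZMOD ((8 * r : ℕ) : ℤ)]),
      ψ (((D / (r : ℤ) : ℤ)) : ZMod n) * (Nat.card (irredOrbitsOfDisc D) : ℂ))
    (N := fun q X => ∑ D ∈ (discWindow 1 X).filter
        (fun D => D ≡ r * s [ZMOD ((8 * r : ℕ) : ℤ)] ∧ (q : ℤ) ^ 2 ∣ D),
        ψ (((D / (r : ℤ) : ℤ)) : ZMod n) * (Nat.card (irredOrbitsOfDisc D) : ℂ))
    (a := fun _ => 0) (b := fun _ => 0) (A := 0) (B := 0) ?_ ?_ ?_ ?_ ?_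
  · intro ε hε
    obtain ⟨C, hC⟩ := h ε hε
    refine ⟨C, fun X hX => ?_⟩
    simpa only [smul_zero, sub_zero] using hC X hX
  · intro X _
    have hid := sum_posFundDiscrs_type_eq_sum_moebius (R := ℂ) hr hs he
      (w := fun D => ψ (((D / (r : ℤ) : ℤ)) : ZMod n) * (Nat.card (irredOrbitsOfDisc D) : ℂ))
      (by simp [irredOrbitsOfDisc_one]) X
    simp only [Complex.real_smul, Complex.ofReal_intCast]
    exact hid
  · intro ε hε
    obtain ⟨C, hC⟩ := hcore ε hε
    refine ⟨C, fun X Q hX hQ hQ4 => ?_⟩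
    simpa only [smul_zero, sub_zero, Complex.real_smul, Complex.ofReal_intCast] using hC X Q hX hQ hQ4
  · intro ε hε
    obtain ⟨C, -, hC⟩ := irredOrbitCount_sqDvd_le_rpow hU hε
    refine ⟨C, fun X q _ hq _ _ hsq => ?_⟩
    exact (norm_sum_twist_le_irredOrbitCount (Or.inl rfl) _ ψ (fun D => D / (r : ℤ)) q X).trans
      (hC 1 (Or.inl rfl) (fun D => D ≡ r * s [ZMOD ((8 * r : ℕ) : ℤ)]) q hq hsq X)
  · exact fun ε _ => ⟨0, fun Q _ => by simp⟩
  · exact fun ε _ => ⟨0, fun Q _ => by simp⟩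

/-! ### `tt_threeTorsion_twoAdic` closed modulo: Hasse's dictionary, the uniformity fact, and the analytic core -/

/-- **`tt_threeTorsion_twoAdic` from Hasse's dictionary, `btt_uniformity_sqDvd`, and the analytic core
of Taniguchi–Thorne for the eight `2`-adic types.** For each admissible type `(r, s)` and sign, the
analytic core is: residue data `a_q`, `b_q` with Euler products `A = 1/(2rπ²)` (`D < 0`), resp.
`1/(6rπ²)` (`D > 0`) — Thm 10 / [TT_L] residues with the local densities of §6.2–6.3 — and some `B`
(the secondary constant), the core bound of §6.1 for the level-`q` counts
`N^∓_q(X) = irredOrbitCount (∓1) {f | Disc f ≡ rs (8r), q² ∣ Disc f} X` in the range `Q ≤ X^{1/4}`,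
the completion estimates for `Σ_{q ≤ Q} μ(q) a_q`, `Σ_{q ≤ Q} μ(q) b_q`; and, for every primitive
`ψ (mod 2ʲ)`, `j ≥ 4`, `ψ⁶ ≠ 1`, the core bound for the `ψ(D/r)`-twisted level-`q` sums (orbital
`L`-functions, Thm 25; entire, no residues). Everything else of the printed proof — Hasse aside — is
proved in the tree: Lemma 21 per type, §6.1's dictionary bookkeeping, reduction to primitive `ψ`
(`ThreeTorsionMeanTwoAdicProofs`), cubic fields ↔ orbits of forms (`…Sieve`, Step 1), the squarefree
sieve per type (Steps 2–4), truncation with uniformity and the choice `Q = X^{5/23}` (this file).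
[cite: TaniguchiThorne2013, Theorem 4 (§6.3) and Theorem 25, via §6.1] -/
theorem tt_threeTorsion_twoAdic_of_core
    (h₁ : threeTorsion_eq_two_mul_cubicFieldCountOfDisc_add_one) (hU : btt_uniformity_sqDvd)
    (hneg : ∀ r ∈ ({1, 4, 8} : Finset ℕ), ∀ s ∈ ({1, 3, 5, 7} : Finset ℤ),
      ttLocalFactorTwo (r * s) = 1 → ∃ a b : ℕ → ℝ, ∃ B : ℝ,
      (∀ ε : ℝ, 0 < ε → ∃ C : ℝ, ∀ X Q : ℕ, 1 ≤ X → 1 ≤ Q → (Q : ℝ) ≤ (X : ℝ) ^ ((1 : ℝ) / 4) →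
        |∑ q ∈ (Icc 1 Q).filter (fun q => ¬ 2 ∣ q), (μ q : ℝ) *
            ((irredOrbitCount (-1)
                {f : BinaryCubic ℤ | f.disc ≡ r * s [ZMOD ((8 * r : ℕ) : ℤ)] ∧ (q : ℤ) ^ 2 ∣ f.disc} X : ℝ)
              - (X : ℝ) * a q - (X : ℝ) ^ ((5 : ℝ) / 6) * b q)|
          ≤ C * (X : ℝ) ^ ε * ((X : ℝ) ^ ((17 : ℝ) / 24) + (Q : ℝ) ^ ((15 : ℝ) / 8) * (X : ℝ) ^ ((3 : ℝ) / 8)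
              + (Q : ℝ) ^ ((7 : ℝ) / 2) + (X : ℝ) / Q)) ∧
      (∀ ε : ℝ, 0 < ε → ∃ C : ℝ, ∀ Q : ℕ, 1 ≤ Q →
        |1 / (2 * r * Real.pi ^ 2) - ∑ q ∈ (Icc 1 Q).filter (fun q => ¬ 2 ∣ q), (μ q : ℝ) * a q|
          ≤ C * (Q : ℝ) ^ ε / Q) ∧
      (∀ ε : ℝ, 0 < ε → ∃ C : ℝ, ∀ Q : ℕ, 1 ≤ Q →
        |B - ∑ q ∈ (Icc 1 Q).filter (fun q => ¬ 2 ∣ q), (μ q : ℝ) * b q|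
          ≤ C * (Q : ℝ) ^ ε / (Q : ℝ) ^ ((2 : ℝ) / 3)))
    (hpos : ∀ r ∈ ({1, 4, 8} : Finset ℕ), ∀ s ∈ ({1, 3, 5, 7} : Finset ℤ),
      ttLocalFactorTwo (r * s) = 1 → ∃ a b : ℕ → ℝ, ∃ B : ℝ,
      (∀ ε : ℝ, 0 < ε → ∃ C : ℝ, ∀ X Q : ℕ, 1 ≤ X → 1 ≤ Q → (Q : ℝ) ≤ (X : ℝ) ^ ((1 : ℝ) / 4) →
        |∑ q ∈ (Icc 1 Q).filter (fun q => ¬ 2 ∣ q), (μ q : ℝ) *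
            ((irredOrbitCount 1
                {f : BinaryCubic ℤ | f.disc ≡ r * s [ZMOD ((8 * r : ℕ) : ℤ)] ∧ (q : ℤ) ^ 2 ∣ f.disc} X : ℝ)
              - (X : ℝ) * a q - (X : ℝ) ^ ((5 : ℝ) / 6) * b q)|
          ≤ C * (X : ℝ) ^ ε * ((X : ℝ) ^ ((17 : ℝ) / 24) + (Q : ℝ) ^ ((15 : ℝ) / 8) * (X : ℝ) ^ ((3 : ℝ) / 8)
              + (Q : ℝ) ^ ((7 : ℝ) / 2) + (X : ℝ) / Q)) ∧
      (∀ ε : ℝ, 0 < ε → ∃ C : ℝ, ∀ Q : ℕ, 1 ≤ Q →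
        |1 / (6 * r * Real.pi ^ 2) - ∑ q ∈ (Icc 1 Q).filter (fun q => ¬ 2 ∣ q), (μ q : ℝ) * a q|
          ≤ C * (Q : ℝ) ^ ε / Q) ∧
      (∀ ε : ℝ, 0 < ε → ∃ C : ℝ, ∀ Q : ℕ, 1 ≤ Q →
        |B - ∑ q ∈ (Icc 1 Q).filter (fun q => ¬ 2 ∣ q), (μ q : ℝ) * b q|
          ≤ C * (Q : ℝ) ^ ε / (Q : ℝ) ^ ((2 : ℝ) / 3)))
    (htwist : ∀ r ∈ ({1, 4, 8} : Finset ℕ), ∀ s ∈ ({1, 3, 5, 7} : Finset ℤ),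
      ttLocalFactorTwo (r * s) = 1 → ∀ j : ℕ, 4 ≤ j → ∀ ψ : DirichletCharacter ℂ (2 ^ j),
      ψ.IsPrimitive → ψ ^ 6 ≠ 1 → ∀ σ : ℤ, (σ = 1 ∨ σ = -1) →
      ∀ ε : ℝ, 0 < ε → ∃ C : ℝ, ∀ X Q : ℕ, 1 ≤ X → 1 ≤ Q → (Q : ℝ) ≤ (X : ℝ) ^ ((1 : ℝ) / 4) →
        ‖∑ q ∈ (Icc 1 Q).filter (fun q => ¬ 2 ∣ q), (μ q : ℂ) *
            ∑ D ∈ (discWindow σ X).filter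
              (fun D => D ≡ r * s [ZMOD ((8 * r : ℕ) : ℤ)] ∧ (q : ℤ) ^ 2 ∣ D),
              ψ (((D / (r : ℤ) : ℤ)) : ZMod (2 ^ j)) * (Nat.card (irredOrbitsOfDisc D) : ℂ)‖
          ≤ C * (X : ℝ) ^ ε * ((X : ℝ) ^ ((17 : ℝ) / 24) + (Q : ℝ) ^ ((15 : ℝ) / 8) * (X : ℝ) ^ ((3 : ℝ) / 8)
              + (Q : ℝ) ^ ((7 : ℝ) / 2) + (X : ℝ) / Q)) :
    tt_threeTorsion_twoAdic := by
  refine tt_threeTorsion_twoAdic_of_hasse_of_irredOrbitCount h₁ (fun r hr s hs he => ⟨?_, ?_⟩)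
    (fun r hr s hs he j hj ψ hψ hψ6 => ⟨?_, ?_⟩)
  · obtain ⟨a, b, B, hcore, ha, hb⟩ := hneg r hr s hs he
    exact ⟨B, tt_typeCount_neg_of_core hU hr hs he hcore ha hb⟩
  · obtain ⟨a, b, B, hcore, ha, hb⟩ := hpos r hr s hs he
    exact ⟨B, tt_typeCount_pos_of_core hU hr hs he hcore ha hb⟩
  · exact tt_typeTwist_neg_of_core hU hr hs he ψ (htwist r hr s hs he j hj ψ hψ hψ6 (-1) (Or.inr rfl))
  · exact tt_typeTwist_pos_of_core hU hr hs he ψ (htwist r hr s hs he j hj ψ hψ hψ6 1 (Or.inl rfl))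

end Literature.NumberTheory.CubicFields

end
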